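import Literature.Analysis.FluidPDE.ClassicalSolutionCalculus
import HarnessLib

/-!
# The `L²` balance of a weighted jointly smooth scalar field on a slab (static singular weights)

Analysis/FluidPDE proof file (theorems only; no definitions, no named facts) on the way to
`Literature.Analysis.FluidPDE.Wei2016_logModulus_regularity`
(`LeiZhang2017AxisymmetricCriteria.lean`). The energy method of D. Wei, J. Math. Anal. Appl.
435 (2016) = arXiv:1508.03318, §3 ("By applying standard energy estimate to `J` equation, we have
`½ d/dt ‖J‖²_{L²} + … = 0`", (3.1)–(3.2)) is run on the quantities `J = −∂_z(u_θ/r)` and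
`Ω = ω_θ/r`, which off the axis are a *static* (time-independent) weight times a jointly smooth
field: `∂_z(u_θ/r) = r⁻² ∂_z Γ`, `ω_θ/r = r⁻² swirl ω`. The time part of the energy identity
therefore needs only the following weighted twin of the tree's
`IsSmoothSpaceTimeOn.l2_balance` (`ClassicalL2Stability.lean`), in which the weight `ρ` is an
arbitrary measurable function of `x` (no continuity, so that `ρ = r⁻²` is allowed) and all the
regularity is carried by the smooth factor:

* `Wei2016.integrable_sq_of_lintegral` — `f² ∈ L¹` for a measurable real `f` with `∫ |f|² < ∞`;
* `Wei2016.weighted_sq_balance` — for `g` jointly smooth on `[0, T] × ℝ³` (real valued), `ρ`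
  measurable, with `∫ (ρ g(t))² ≤ C₀` and `∫ (ρ ∂ₜg(t))² ≤ C₁` on `[0, T]` (`∂ₜ` the one-sided
  derivative within `[0, T]`): the density `t ↦ ∫ 2 (ρ g)(ρ ∂ₜg)` is integrable on `(0, T)`,
  `E(t) = ∫ (ρ g(t))²` is continuous on `[0, T]`, and `E(b) = E(0) + ∫₀ᵇ ∫ 2 (ρ g)(ρ ∂ₜg)` for
  `b ∈ (0, T]`.

Proof: as for `l2_balance` — `d/dt (ρ g)² = 2 ρ² g ∂ₜg` on each time line (the weight is
constant in `t`), the fundamental theorem of calculus in `t` for each `x`, and Fubini; the joint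
measurability of the density is that of a product of a jointly continuous function with a
measurable function of `x`.

## References

* D. Wei, arXiv:1508.03318, §3, (3.1)–(3.2) (the energy identities for `J` and `Ω`). [Wei2016]
* J. C. Robinson, J. L. Rodrigo, W. Sadowski, *The Three-Dimensional Navier–Stokes Equations*,
  CUP 2016, proof of Thm. 6.10 (the `L²` balance; tree: `IsSmoothSpaceTimeOn.l2_balance`).
  [RobinsonRodrigoSadowski2016]
-/

noncomputable section

open MeasureTheory Set Function Filter Topology
open scoped ENNReal NNReal ContDiff

namespace Literature.Analysis.FluidPDE

namespace Wei2016

/-- `f² ∈ L¹` for an a.e. strongly measurable real `f` with `∫⁻ |f|² < ∞`. [folklore] -/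
theorem integrable_sq_of_lintegral {X : Type*} [MeasurableSpace X] {μ : Measure X} {f : X → ℝ}
    (hf : AEStronglyMeasurable f μ) (h : ∫⁻ x, ‖f x‖ₑ ^ 2 ∂μ < ⊤) :
    Integrable (fun x => f x ^ 2) μ := by
  refine ⟨hf.pow 2, ?_⟩
  rw [HasFiniteIntegral]
  refine lt_of_le_of_lt (lintegral_mono fun x => ?_) h
  rw [← enorm_pow]

/-- **The weighted `L²` balance on a closed slab.** For `g : ℝ → ℝ³ → ℝ` jointly smooth on
`[0, T] × ℝ³`, a measurable static weight `ρ : ℝ³ → ℝ`, and bounds `∫ (ρ g(t))² ≤ C₀`,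
`∫ (ρ ∂ₜg(t))² ≤ C₁` on `[0, T]` (`∂ₜg` the one-sided time derivative within `[0, T]`), with
`E(t) = ∫ (ρ g(t))²` and `Φ(t) = ∫ 2 (ρ g(t)) (ρ ∂ₜg(t))`: `Φ` is integrable on `(0, T)`, `E` is
continuous on `[0, T]`, and `E(b) = E(0) + ∫₀ᵇ Φ` for `b ∈ (0, T]`. The weighted twin of the
tree's `IsSmoothSpaceTimeOn.l2_balance` (there `ρ = 1` and `g` is vector valued); used with
`ρ = r⁻²` for Wei's `J = −r⁻² ∂_zΓ` and `Ω = r⁻² swirl ω`. [folklore] -/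
theorem weighted_sq_balance {T : ℝ} (hT : 0 < T) {g : ℝ → EuclideanSpace ℝ (Fin 3) → ℝ}
    (hg : FluidPDE.IsSmoothSpaceTimeOn (Icc 0 T) g) {ρ : EuclideanSpace ℝ (Fin 3) → ℝ}
    (hρ : Measurable ρ) {C₀ C₁ : ℝ≥0}
    (hC₀ : ∀ t ∈ Icc 0 T, ∫⁻ x, ‖ρ x * g t x‖ₑ ^ 2 ≤ C₀)
    (hC₁ : ∀ t ∈ Icc 0 T, ∫⁻ x, ‖ρ x * FluidPDE.timeDerivWithin (Icc 0 T) g t x‖ₑ ^ 2 ≤ C₁) :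
    IntegrableOn (fun t => ∫ x, 2 * (ρ x * g t x) *
        (ρ x * FluidPDE.timeDerivWithin (Icc 0 T) g t x)) (Ioo 0 T) ∧
    ContinuousOn (fun t => ∫ x, (ρ x * g t x) ^ 2) (Icc 0 T) ∧
    ∀ b ∈ Ioc 0 T, ∫ x, (ρ x * g b x) ^ 2 =
      (∫ x, (ρ x * g 0 x) ^ 2) + ∫ t in (0 : ℝ)..b, ∫ x, 2 * (ρ x * g t x) *
        (ρ x * FluidPDE.timeDerivWithin (Icc 0 T) g t x) := by
  have hU : UniqueDiffOn ℝ (Icc 0 T) := uniqueDiffOn_Icc hT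
  set W : ℝ → EuclideanSpace ℝ (Fin 3) → ℝ := FluidPDE.timeDerivWithin (Icc 0 T) g with hW
  have hWsm : FluidPDE.IsSmoothSpaceTimeOn (Icc 0 T) W := hg.timeDerivWithin hU
  have cg : ContinuousOn (uncurry g) (Icc 0 T ×ˢ univ) := hg.continuousOn
  have cW : ContinuousOn (uncurry W) (Icc 0 T ×ˢ univ) := hWsm.continuousOn
  -- the density `d t x = 2 (ρ g)(ρ W)` and the energy `E t = ∫ (ρ g(t))²`
  obtain ⟨d, hd⟩ : ∃ d : ℝ → EuclideanSpace ℝ (Fin 3) → ℝ,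
      d = fun t x => 2 * (ρ x * g t x) * (ρ x * W t x) := ⟨_, rfl⟩
  obtain ⟨E, hE⟩ : ∃ E : ℝ → ℝ, E = fun t => ∫ x, (ρ x * g t x) ^ 2 := ⟨_, rfl⟩
  have hdt : ∀ t x, d t x = 2 * (ρ x * g t x) * (ρ x * W t x) := fun t x => by rw [hd]
  have hEt : ∀ t, E t = ∫ x, (ρ x * g t x) ^ 2 := fun t => by rw [hE]
  -- slices
  have cgt : ∀ t ∈ Icc 0 T, Continuous (g t) := fun t ht => (hg.contDiff_slice ht).continuous
  have cWt : ∀ t ∈ Icc 0 T, Continuous (W t) := fun t ht => (hWsm.contDiff_slice ht).continuous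
  have mρg : ∀ t ∈ Icc 0 T, AEStronglyMeasurable (fun x => ρ x * g t x) volume := fun t ht =>
    (hρ.aestronglyMeasurable.mul (cgt t ht).aestronglyMeasurable)
  have mρW : ∀ t ∈ Icc 0 T, AEStronglyMeasurable (fun x => ρ x * W t x) volume := fun t ht =>
    (hρ.aestronglyMeasurable.mul (cWt t ht).aestronglyMeasurable)
  have isq : ∀ t ∈ Icc 0 T, Integrable (fun x => (ρ x * g t x) ^ 2) volume := fun t ht =>
    integrable_sq_of_lintegral (mρg t ht) ((hC₀ t ht).trans_lt ENNReal.coe_lt_top)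
  -- pointwise bound `|d| ≤ (ρ g)² + (ρ W)²` and the `lintegral` bound of `d(t, ·)`
  have hdle : ∀ t x, ‖d t x‖ ≤ (ρ x * g t x) ^ 2 + (ρ x * W t x) ^ 2 := by
    intro t x
    rw [hdt, Real.norm_eq_abs]
    have h2 : |2 * (ρ x * g t x) * (ρ x * W t x)| = 2 * |ρ x * g t x| * |ρ x * W t x| := by
      rw [abs_mul, abs_mul, abs_two]
    rw [h2]
    nlinarith [sq_nonneg (|ρ x * g t x| - |ρ x * W t x|), sq_abs (ρ x * g t x),
      sq_abs (ρ x * W t x)]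
  have hd_lint : ∀ t ∈ Icc 0 T, ∫⁻ x, ‖d t x‖ₑ ≤ C₀ + C₁ := by
    intro t ht
    have hpt : ∀ x, ‖d t x‖ₑ ≤ ‖ρ x * g t x‖ₑ ^ 2 + ‖ρ x * W t x‖ₑ ^ 2 := by
      intro x
      have hR : ‖ρ x * g t x‖ₑ ^ 2 + ‖ρ x * W t x‖ₑ ^ 2 =
          ENNReal.ofReal ((ρ x * g t x) ^ 2 + (ρ x * W t x) ^ 2) := by
        rw [ENNReal.ofReal_add (sq_nonneg _) (sq_nonneg _), ← sq_abs (ρ x * g t x),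
          ← sq_abs (ρ x * W t x), ENNReal.ofReal_pow (abs_nonneg _),
          ENNReal.ofReal_pow (abs_nonneg _), ← Real.norm_eq_abs, ← Real.norm_eq_abs, ofReal_norm,
          ofReal_norm]
      rw [hR, ← ofReal_norm]
      exact ENNReal.ofReal_le_ofReal (hdle t x)
    calc ∫⁻ x, ‖d t x‖ₑ ≤ ∫⁻ x, (‖ρ x * g t x‖ₑ ^ 2 + ‖ρ x * W t x‖ₑ ^ 2) := lintegral_mono hpt
      _ = (∫⁻ x, ‖ρ x * g t x‖ₑ ^ 2) + ∫⁻ x, ‖ρ x * W t x‖ₑ ^ 2 := by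
          rw [lintegral_add_left']
          exact (mρg t ht).aemeasurable.enorm.pow_const _
      _ ≤ C₀ + C₁ := add_le_add (hC₀ t ht) (hC₁ t ht)
  have hKfin : ((C₀ : ℝ≥0∞) + C₁) ≠ ⊤ :=
    ENNReal.add_ne_top.2 ⟨ENNReal.coe_ne_top, ENNReal.coe_ne_top⟩
  -- joint measurability of the density on `(0, b) × ℝ³` and its integrability
  have hd_meas : ∀ b ∈ Ioc 0 T, AEStronglyMeasurable (uncurry d)
      (((volume : Measure ℝ).restrict (Ioo 0 b)).prod volume) := by
    intro b hb
    have hsub : Icc 0 b ×ˢ (univ : Set (EuclideanSpace ℝ (Fin 3))) ⊆ Icc 0 T ×ˢ univ :=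
      prod_mono (Icc_subset_Icc le_rfl hb.2) Subset.rfl
    have mg := FluidPDE.aestronglyMeasurable_prod_of_continuousOn (cg.mono hsub)
    have mW := FluidPDE.aestronglyMeasurable_prod_of_continuousOn (cW.mono hsub)
    have mρ' : AEStronglyMeasurable (fun p : ℝ × EuclideanSpace ℝ (Fin 3) => ρ p.2)
        (((volume : Measure ℝ).restrict (Ioo 0 b)).prod volume) :=
      (hρ.comp measurable_snd).aestronglyMeasurable
    have h : AEStronglyMeasurable (fun p : ℝ × EuclideanSpace ℝ (Fin 3) =>
        2 * (ρ p.2 * uncurry g p) * (ρ p.2 * uncurry W p))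
        (((volume : Measure ℝ).restrict (Ioo 0 b)).prod volume) :=
      ((aestronglyMeasurable_const.mul (mρ'.mul mg)).mul (mρ'.mul mW))
    refine h.congr (Eventually.of_forall fun p => ?_)
    simp only [uncurry, hdt]
  have hd_int : ∀ b ∈ Ioc 0 T, Integrable (uncurry d)
      (((volume : Measure ℝ).restrict (Ioo 0 b)).prod volume) := by
    intro b hb
    refine ⟨hd_meas b hb, ?_⟩
    rw [HasFiniteIntegral, lintegral_prod _ (hd_meas b hb).enorm]
    calc ∫⁻ t in Ioo 0 b, ∫⁻ x, ‖uncurry d (t, x)‖ₑ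
        ≤ ∫⁻ _ in Ioo 0 b, ((C₀ : ℝ≥0∞) + C₁) :=
          setLIntegral_mono' measurableSet_Ioo fun t ht =>
            hd_lint t ⟨ht.1.le, ht.2.le.trans hb.2⟩
      _ < ⊤ := by
          rw [setLIntegral_const]
          exact ENNReal.mul_lt_top hKfin.lt_top (by simp)
  -- the time derivative of `(ρ g)²` at interior times
  have hderiv : ∀ t ∈ Ioo 0 T, ∀ x, HasDerivAt (fun τ => (ρ x * g τ x) ^ 2) (d t x) t := by
    intro t ht x
    have h1 : HasDerivAt (fun τ => g τ x) (W t x) t :=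
      (hg.hasDerivWithinAt_timeDerivWithin hU (Ioo_subset_Icc_self ht) x).hasDerivAt
        (Icc_mem_nhds ht.1 ht.2)
    have h2 := (h1.const_mul (ρ x)).pow 2
    rw [hdt]
    refine h2.congr_deriv ?_
    ring
  -- FTC in `t` for each `x`, on `[0, b]`
  have hFTC : ∀ b ∈ Ioc 0 T, ∀ x, ∫ t in (0 : ℝ)..b, d t x =
      (ρ x * g b x) ^ 2 - (ρ x * g 0 x) ^ 2 := by
    intro b hb x
    have hsub : Icc 0 b ⊆ Icc 0 T := Icc_subset_Icc le_rfl hb.2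
    have hc : ContinuousOn (fun τ => ((τ, x) : ℝ × EuclideanSpace ℝ (Fin 3))) (Icc 0 b) :=
      (continuous_id.prodMk continuous_const).continuousOn
    have hmaps : MapsTo (fun τ => ((τ, x) : ℝ × EuclideanSpace ℝ (Fin 3))) (Icc 0 b)
        (Icc 0 T ×ˢ univ) := fun τ hτ => mk_mem_prod (hsub hτ) (mem_univ x)
    have hcg : ContinuousOn (fun τ => g τ x) (Icc 0 b) := (cg.comp hc hmaps).congr fun τ _ => rfl
    have hcW : ContinuousOn (fun τ => W τ x) (Icc 0 b) := (cW.comp hc hmaps).congr fun τ _ => rfl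
    have hcont : ContinuousOn (fun τ => (ρ x * g τ x) ^ 2) (Icc 0 b) :=
      (continuousOn_const.mul hcg).pow 2
    have hcont' : ContinuousOn (fun τ => d τ x) (Icc 0 b) := by
      have h : ContinuousOn (fun τ => 2 * (ρ x * g τ x) * (ρ x * W τ x)) (Icc 0 b) :=
        (continuousOn_const.mul (continuousOn_const.mul hcg)).mul (continuousOn_const.mul hcW)
      refine h.congr fun τ _ => ?_
      rw [hdt]
    exact intervalIntegral.integral_eq_sub_of_hasDerivAt_of_le (f := fun τ => (ρ x * g τ x) ^ 2)
      (f' := fun τ => d τ x) hb.1.le hcont (fun t ht => hderiv t ⟨ht.1, ht.2.trans_le hb.2⟩ x)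
      (hcont'.intervalIntegrable_of_Icc hb.1.le)
  -- Fubini: `E b - E 0 = ∫₀ᵇ ∫ d`
  obtain ⟨φ, hφ⟩ : ∃ φ : ℝ → ℝ, φ = fun t => ∫ x, d t x := ⟨_, rfl⟩
  have hφt : ∀ t, φ t = ∫ x, d t x := fun t => by rw [hφ]
  have hφ_int : IntegrableOn φ (Ioo 0 T) volume := by
    rw [hφ]; exact (hd_int T ⟨hT, le_rfl⟩).integral_prod_left
  have hEb : ∀ b ∈ Ioc 0 T, E b = E 0 + ∫ t in (0 : ℝ)..b, φ t := by
    intro b hb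
    have hI := hd_int b hb
    have hswap := integral_integral_swap (μ := (volume : Measure ℝ).restrict (Ioo 0 b))
      (ν := (volume : Measure (EuclideanSpace ℝ (Fin 3)))) (f := fun t x => d t x) hI
    have hx : ∫ x, ∫ t in Ioo 0 b, d t x = E b - E 0 := by
      have : (fun x => ∫ t in Ioo 0 b, d t x) = fun x => (ρ x * g b x) ^ 2 - (ρ x * g 0 x) ^ 2 := by
        funext x
        rw [← hFTC b hb x, intervalIntegral.integral_of_le hb.1.le, integral_Ioc_eq_integral_Ioo]
      rw [this, integral_sub (isq b ⟨hb.1.le, hb.2⟩) (isq 0 ⟨le_rfl, hT.le⟩), hEt, hEt]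
    rw [intervalIntegral.integral_of_le hb.1.le, integral_Ioc_eq_integral_Ioo]
    simp only [hφt]
    rw [hswap, hx]
    ring
  -- continuity of `E` on `[0, T]`
  have hEcont : ContinuousOn E (Icc 0 T) := by
    have hprim : ContinuousOn (fun b => ∫ t in (0 : ℝ)..b, φ t) (Icc 0 T) := by
      have h := intervalIntegral.continuousOn_primitive_interval (μ := volume) (f := φ) (a := 0)
        (b := T) (by
          rw [uIcc_of_le hT.le]
          exact (hφ_int.congr_set_ae Ioo_ae_eq_Icc.symm))
      rwa [uIcc_of_le hT.le] at h
    have heq : ∀ b ∈ Icc 0 T, E b = E 0 + ∫ t in (0 : ℝ)..b, φ t := by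
      intro b hb
      rcases eq_or_lt_of_le hb.1 with h | h
      · rw [← h]; simp
      · exact hEb b ⟨h, hb.2⟩
    exact (continuousOn_const.add hprim).congr heq
  refine ⟨?_, ?_, fun b hb => ?_⟩
  · refine hφ_int.congr_fun (fun t _ => ?_) measurableSet_Ioo
    rw [hφt]
    refine integral_congr_ae (Eventually.of_forall fun x => ?_)
    simp only [hdt]
  · rw [hE] at hEcont
    exact hEcont
  · have h := hEb b hb
    rw [hEt, hEt] at h
    rw [h]
    congr 1
    refine intervalIntegral.integral_congr fun t _ => ?_
    simp only [hφt]
    refine integral_congr_ae (Eventually.of_forall fun x => ?_)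
    simp only [hdt]

end Wei2016

end Literature.Analysis.FluidPDE

end
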